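import Summits.ResolutionOfSingularities.ResolutionOfSingularities.Theorems.FrobeniusLadderFInjectiveMacaulayficationKLocCellSound
import HarnessLib

/-!
# Order-blind entry point for the `KLocCell` certificate kit (crux `FInjectiveMacaulayfication`, road B / G2–G3) — kit hardening

[OURS · L1 W4.5a] Support file for crux stmt-ResolutionOfSingularities-15315 (res-L1-w45a-plan-1 R12.41 / R12.43 / R12.44 (4): «kit
hardening (`checkKs` sorts `G` once) = a later stub-6-class item»; author = the kit's author res-D-pv-018 AS res-L1-w45a-stub-6).
FINDING OF RECORD (res-D-pv-035 10:07:47Z = res-L1-w45a-stub-1 10:12:54Z, R12.41): `KLocCellKit.cofactorNFK` forms `mulK (withKey T₀) GK`,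
and the merge-based normalising product `mulK A B` yields a normal form only when `B` is KEY-SORTED; so `checkKs p G cells` is `false`
(never unsound) whenever a cell has `t₀ ≠ 0` and the chart polynomial `G` is listed in an order other than ascending kit-key order
(key `= e 0 + 2²⁰·e 1 + 2⁴⁰·e 2 + …`, i.e. ascending lexicographic on `(e_{n-1}, …, e_0)`).  This file adds, WITHOUT touching the landed
kit: `normL G` = the kit-normalised copy of `G` (its `mulK`-product with the unit term, keys stripped — sorted and collected), the check
`checkKsN p G cells := checkKs p (normL G) cells` (so `G` may be listed in ANY order, e.g. a certificate's JSON order), the soundness of the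
normalisation `evalL_normL : evalL K (normL G) = evalL K G`, and the packaged theorem `klocCells_of_checkN` with the SAME conclusion as
`klocCells_of_check` (the §3 cells binder of `KLocCell` p516325 for `g = evalL K G`, `G` as listed).  Definitions are computable list
programs (no instances, no notation); AI-written, weaker than expert review; no statement of [claim: Hironaka2017] is used. [folklore]
-/

-- single-problem summit: the doubled namespace component is forced
set_option linter.dupNamespace false

namespace Summit.ResolutionOfSingularities.ResolutionOfSingularities.Theorems.FInjectiveMacaulayfication.KLocCellKit

open MvPolynomial

variable {n : ℕ}

/-- The kit-NORMALISED copy of a term list (key-sorted ascending, equal exponents collected): the `mulK`-product of `withKey G` with the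
unit term `(1, 0, 0)`, keys stripped. [folklore] -/
def normL (G : List (ℤ × (Fin n → ℕ))) : List (ℤ × (Fin n → ℕ)) :=
  (mulK (withKey G) [((1 : ℤ), (0 : ℕ), (0 : Fin n → ℕ))]).map fun t => (t.1, t.2.2)

/-- **Order-blind check** of all cells of one chart: `checkKs` run on the normalised term list `normL G`, so the chart polynomial may be
listed in any term order. [folklore] -/
def checkKsN (p : ℕ) (G : List (ℤ × (Fin n → ℕ)))
    (cells : List (Finset (Fin n) × List ((Fin n → ℕ) × List (ℤ × (Fin n → ℕ))) × (Fin n → List (ℤ × (Fin n → ℕ))) ×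
      List (ℤ × (Fin n → ℕ)))) : Bool :=
  checkKs p (normL G) cells

variable (K : Type) [Field K]

/-- Stripping keys and re-reading as a plain term list does not change the value. [folklore] -/
theorem evalL_map_strip (L : List (ℤ × ℕ × (Fin n → ℕ))) :
    evalL K (L.map fun t => (t.1, t.2.2)) = evalK K L := by
  simp only [evalL, evalK, List.map_map, Function.comp_def]

/-- **Normalisation is sound**: `evalL K (normL G) = evalL K G`. [folklore] -/
theorem evalL_normL (G : List (ℤ × (Fin n → ℕ))) : evalL K (normL G) = evalL K G := by
  rw [normL, evalL_map_strip, evalK_mulK, evalK_withKey, evalK_cons, evalK_nil, add_zero]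
  simp only [Int.cast_one, monomial_symm_zero, mul_one]

/-- **ALL G2 CELLS OF ONE CHART FROM ONE ORDER-BLIND KERNEL CHECK**: from `checkKsN p G cells = true` — one `decide` — the §3
hypothesis `∀ S ∈ SS, ∃ L rr t t₀, …` of `KLocCell` for `SS = cells.map Prod.fst` and `g = evalL K G` with `G` AS LISTED (same
conclusion as `klocCells_of_check`). [folklore] -/
theorem klocCells_of_checkN (p : ℕ) [Fact p.Prime] [CharP K p] (G : List (ℤ × (Fin n → ℕ)))
    (cells : List (Finset (Fin n) × List ((Fin n → ℕ) × List (ℤ × (Fin n → ℕ))) × (Fin n → List (ℤ × (Fin n → ℕ))) ×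
      List (ℤ × (Fin n → ℕ))))
    (hcheck : checkKsN p G cells = true) :
    ∀ S ∈ cells.map Prod.fst, ∃ (L : List ((Fin n →₀ ℕ) × MvPolynomial (Fin n) K)) (rr : List (MvPolynomial (Fin n) K))
      (t : Fin n → MvPolynomial (Fin n) K) (t₀ : MvPolynomial (Fin n) K),
      (L.map Prod.fst).Nodup ∧ (∀ e ∈ L, ∀ i : Fin n, e.1 i < p) ∧
      evalL K G ^ (p - 1) = (L.map fun e => MvPolynomial.monomial e.1 (1 : K) * MvPolynomial.expand p e.2).sum ∧
      (1 : MvPolynomial (Fin n) K) = (List.zipWith (fun r e => r * MvPolynomial.expand p e.2) rr L).sum +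
        ∑ i ∈ S, t i * MvPolynomial.X i + t₀ * evalL K G := by
  have h := klocCells_of_check K p (normL G) cells hcheck
  rw [evalL_normL] at h
  exact h

end Summit.ResolutionOfSingularities.ResolutionOfSingularities.Theorems.FInjectiveMacaulayfication.KLocCellKit
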